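import Mathlib
import HarnessLib
import HarnessLib.Audit
import Summits.Parity.Statement

/-!
Route: UnimodularColumns

CLOSED (retired) 2026-08-15T13:50:50Z by operator:999:1257524 — reason: not-a-thesis: assembly does not conclude the sub-problem Statement — note: D-0027 §2.1 audit (human 2026-08-15: routes that do not decide the summit are removed): the assembly concludes `Literature.NumberTheory.Sieve.HardyLittlewoodConjE`, not the sub-problem statement; a NEW conforming route may be opened from the same idea (generated `closes : … → _root_.BatemanHorn`).. The file is kept as the record of this route; refuted decls are indexed as negative knowledge (`ledger negatives`).

X_UC (UnimodularColumns). First open instance f = X²+1 (Hardy–Littlewood E ⊂ BatemanHorn); the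
dictionary below is specific to degree 2 (and, for discriminant −4, to class number one). By
Lagrange's identity (a²+c²)(b²+d²) − (ab+cd)² = (ad−bc)², the map γ = (a b; c d) ↦ (m, ν, m') =
(a²+c², ab+cd, b²+d²) is a 4-to-1 surjection from SL₂(ℤ) onto the factorisations ν²+1 = m·m' (m, m'
≥ 1, ν ∈ ℤ), with ‖γ‖² = m + m' (support LagrangeDictionary: reduction of positive forms of
discriminant −4, |SO₂(ℤ)| = 4). Hence every divisor statistic of n²+1 — in particular the parity
window (W) of route QuadraticRoots (Möbius-twisted counts of roots ν ≤ x of ν² ≡ −1 mod d, d ∈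
[x^{1−η}, x^{1+η}]) — is a lattice-point statistic on SL₂(ℤ) ⊂ SL₂(ℝ) with a multiplicative weight
on ONE COLUMN, and (W) at the balanced point D ≍ x is Möbius randomness of the column norm of a
height-random unimodular matrix:
  ∑_{γ ∈ SL₂(ℤ), ‖γ‖² ≤ N} μ(a²+c²) = o(N)   (crux UnimodularMobius; #{‖γ‖² ≤ N} ≍ N; the fibre over
a column u has O(1) points for |u|² ≍ N, so no smoothing in the second column is available — this is
exactly the small-root regime).
Equivalently, with v = γu ∈ ℤ[i]: Möbius of the norm over Gaussian integers in NEEDLES γ(B_ρ)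
(ellipses of area ≍ x/Y, length ≍ √x, width ≍ √x/Y) on average over γ of height ‖γ‖² ≤ Y. This is a
one-parameter family: fat needles (Y = x^{θ/2}, θ < 1) are Hecke prime-ideal-theorem territory
(support NeedleFamilyFat, NeedleFixed), unit-width needles (Y = √x) are the threshold crux
NeedleFamilyHalf, and Y = x is UnimodularMobius. It suffices to show (W) ∧ (Q_avg) — attached
verbatim from QuadraticRoots, whence Literature.NumberTheory.Sieve.HardyLittlewoodConjE by the
shared Assembly (given the fact Literature.NumberTheory.Sieve.tendsto_hardyLittlewoodE_partial);
this route attacks (W) through the SL₂/needle dictionary. General quadratic f: replace x²+y² by the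
forms of discriminant disc f and SL₂(ℤ) by isometry cosets (not decomposed); deg ≥ 3: route
CubicRoots.
Lean (the new atom, decl UnimodularMobius; elaborates):
(fun N : ℕ => ∑ a ∈ Finset.Icc (-(N : ℤ)) N, ∑ b ∈ Finset.Icc (-(N : ℤ)) N, ∑ c ∈ Finset.Icc (-(N :
ℤ)) N, ∑ d ∈ Finset.Icc (-(N : ℤ)) N, if a * d - b * c = 1 ∧ a ^ 2 + b ^ 2 + c ^ 2 + d ^ 2 ≤ (N : ℤ)
then (ArithmeticFunction.moebius (a ^ 2 + c ^ 2).toNat : ℝ) else 0) =o[Filter.atTop] fun N : ℕ => (N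
: ℝ)

Rationale: WHY THIS LINE (brief = widen: homogeneous dynamics / affine sieve on SL₂(ℤ), plus Hecke L-functions
of ℚ(i)). The quadric {m·m' − ν² = 1} is the homogeneous space SO₂\SL₂ and its integer points form
ONE SL₂(ℤ)-orbit; sieving for (almost-)primes in the coordinates of such orbits is precisely the
affine sieve [BourgainGamburdSarnak2009] and, for ternary quadrics including x₁x₃ − x₂² = t,
[LiuSarnak2010] (almost-prime coordinates from the spectral gap: Selberg/Kim–Sarnak ⇒ level of
distribution on the orbit). Those theorems stop at the parity barrier; UnimodularMobius is the
parity-breaking statement on this orbit, so the route poses the dynamics community's question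
("Möbius randomness along SL₂(ℤ) in archimedean balls"; cf. Möbius disjointness for horocycle orbits
[BourgainSarnakZiegler2013], [Sarnak2010]) in the one instance equivalent to a piece of
Hardy–Littlewood E. Second import: the needle picture makes the family average over γ explicit — for
fat needles the input is Hecke's equidistribution of Gaussian primes in sectors/regions
(Grössencharakter L-functions, zero density), and the SL₂(ℤ)-average is a large-sieve/spectral lever
(Kloosterman ⇄ roots of quadratic congruences [DukeFriedlanderIwaniec1995], [Toth2000],
[DunnEtAl2019]; fine-scale root statistics ⇄ geodesic sections [MarklofWelsh2023]). Smooth-weight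
lattice-point counting on SL₂(ℤ) is classical (Selberg; Duke–Rudnick–Sarnak); the novelty asked for
is a multiplicative weight on one column. Value if it never closes: UnimodularMobius and the needle
family are crisp, parameter-free test statements a refuter can compute (N ~ 10^7) and a grounder can
place against the F_q[T] analogues.
RANKED CRUXES.
 r2 UnimodularMobius (balanced parity atom, new as stated; ⇔ (W)-type cancellation at D ≍ x with the
archimedean weight of the ball).
 r3 NeedleFamilyHalf: ∑_{‖γ‖² ≤ N} |∑_{0<|u|² ≤ N} μ(|γu|²)| = o(N²) (unit-width needles: short sums
of μ(w²+v²), w in intervals of length ≍ √w, averaged over ≍ N^{3/2} pairs (γ, v)).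
 r4 = (W) and r5 = (Q_avg) of QuadraticRoots attached verbatim (stmt-Parity-0648 / 0649): the inputs
of the shared Assembly.
 support r9: NeedleFamilyFat (θ < 1: provable from Hecke PNT for ℤ[i] uniformly in eccentricity N^θ
— grounders: largest θ in print?), NeedleFixed (one γ: PNT for ℤ[i] in a fixed ellipse),
LagrangeDictionary (elementary, provable now).
 r1 Assembly = QuadraticRoots' (stmt-Parity-0647): (W) → (Q_avg) → tendsto_hardyLittlewoodE_partial
→ HardyLittlewoodConjE.
KILL CRITERIA. UnimodularMobius refuted (an Ω(N) lower bound, e.g. a sign bias of μ(a²+c²) against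
the fibre count over SL₂(ℤ)) kills this route AND QuadraticRoots' (W) at D ≍ x. NeedleFamilyHalf
refuted while NeedleFamilyFat holds for every θ < 1 pins the obstruction at unit width ⇒ close (the
SL₂ average adds nothing beyond Hecke). LagrangeDictionary refuted ⇒ my constant 4 / index ranges
are wrong ⇒ re-file (pivot, not close). Assembly refuted ⇒ handled by QuadraticRoots' tenure (shared
item).
NOT DECOMPOSED YET. Bilinear versions over products γ = γ₁γ₂ (Bourgain–Kontorovich-style multilinear
sums on SL₂(ℤ)); UnimodularMobius ⇒ (W) for ALL D in the window (only D ≍ x is literally the ball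
statistic; other D are skewed boxes ‖col₁‖² ≍ D, |ν| ≤ x); general quadratic f (class number > 1); k
≥ 2.

Novelty: NOVELTY (retriage planner, 2026-08-14). Searches run BEFORE this claim: `lit frontier Parity --since
2020` (30 descendants; none on roots/SL₂; arXiv:2605.01155 Banks–Ford random BH sets = model
support, not method), `lit bridges Parity --cross any` (no bridge touching DFI/affine-sieve roots),
`lit search` local x6 (remote OpenAlex/S2/arXiv HTTP 429 all session, Crossref noise), `lit search
--hybrid` x2, `lit vsearch --papers` x2 (0 closer), `lit read` of arXiv:2009.03460 pp.1-3,
arXiv:2601.10113 pp.2-4, arXiv:2008.09905 pp.1-6, arXiv:2505.00493 pp.1-3, arXiv:2407.14368 (grep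
DFI; p.15), book:friedlandernd-analytic-number-theory pp.19-20, book:harman2007 (TOC, Ch.3/11), plus
the grounder/reground page evidence on items 0882-0886 (Iwaniec2002 Cor 12.2 p.126; HLR2020 p.3/p.5;
Harman2007 pp.202-203; BGS2009 p.2; BSZ2013 Thm 1).
Nearest prior art actually FOUND and the delta:
(i) SAME OBJECTS, OTHER WEIGHT: DukeFriedlanderIwaniec1995 / Toth2000 / DunnEtAl2019 and now
Grimmelt–Merikoski arXiv:2505.00493 Thms 1.4–1.5 (uniform Type-I level X^{1/2}, Type-II N ≤ X^{1/3}
for the roots of aℓ²+h ≡ 0 mod k, 'independent of progress towards Selberg', via weighted SL₂(ℝ)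
automorphic kernels arXiv:2505.00489) treat exactly the Weyl sums ρ_h(d) of roots of ν²≡−1 (mod d)
and deduce equidistribution to PRIME moduli; FordMaynard2024 p.15: '(γ,θ,ν)=(1/2,0,1/3) … C⁻=C⁺=1 …
a limiting version was used by DFI'. The route puts μ(d) on the modulus instead of restricting d to
primes. Retriage assessment  [refs: 2605.01155, 2009.03460, 2601.10113, 2008.09905, 2505.00493, 2407.14368, 2505.00489, 1908.08816, book:friedlandernd-analytic-number-theory, book:harman2007, Iwaniec2002, Harman2007, DukeFriedlanderIwaniec1995, Toth2000, DunnEtAl2019, FordMaynard2024, BourgainGamburdSarnak2009, LiuSarnak2010, BourgainSarnakZiegler2013, HuangLiuRudnick2020, SawinShusterman2022, Merikoski2022, ConradConradGross2008, M]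

Barriers (technique_class: spectral type-I/II on moduli; SL2 lattice; Hecke sectors): BARRIERS (catalogue Literature/Barriers/Parity read 2026-08-14; one line per catalogued fact named
by the gate, then the remaining relevant entries: applies / evaded / honest non-evasion).
Literature.Barriers.Parity.SelbergParityBarrier: APPLIES to the Assembly's skeleton — Λ(n²+1) =
Σ_{de=n²+1} μ(d) log e with T1 = Type-I data of level x^{1−η} in n (= X^{1/2−η/2} in the value scale
X ≍ x²); no functional of T1 yields Literature.NumberTheory.Sieve.HardyLittlewoodConjE
(no_typeI_prime_lower_bound_allModuli). Evasion: the two non-Type-I hypotheses are NAMED, not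
derived — WindowW (μ(d)-cancellation over moduli d ∈ [x^{1−η},x^{1+η}]) and CofactorAvg (Möbius
randomness of the cofactor > x^{1+η}). Honest: for WindowW/UnimodularMobius the bet is concrete
(spectral bilinear structure in the modulus: DukeFriedlanderIwaniec1995/Toth2000, arXiv:2505.00493
give (γ,θ,ν)=(1/2,0,1/3) on the roots sequence — parity-breaking Type-II input on the MODULUS side);
for CofactorAvg no mechanism is proposed — it does not evade; the bet is μ-specific cancellation
along n²+1 (Chowla-type), open.
Literature.Barriers.Parity.FordMaynardLowLevel: APPLIES through the thin-set dictionary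
(FordMaynard2024 §2.4): {n²+1 ≤ X} has X^{1/2} elements, c = 1/2 ⇒ Type-I at best γ < 1/2 and NO
Type-II range with θ < 1/2 in the VALUE variable ('e.g. the values of one polynomial of degree ≥
2'). The route's Type-I/II information lives on the MODULUS d | n²+1 (roots sequence: positive
density in d, divisor-bounded), whe

History (route lifecycle, newest last):
- 2026-08-15T13:50:50Z · CLOSED retired — not-a-thesis: assembly does not conclude the sub-problem Statement (operator:999:1257524)

sub-problem: BatemanHorn · status: closed(retired) · opened planner-plan-Parity-BatemanHorn-0 2026-08-13T19:23:18Z · rev 1 · ledger route-Parity-UnimodularColumns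
GENERATED by the gate from the ledger (D-0016/17). Provers cite these decls: `theorem foo : Summit.Parity.BatemanHorn.Theses.UnimodularColumns.<Decl> := …` in Summits/Parity/BatemanHorn/Theorems/<Name>.lean.
-/

namespace Summit.Parity.BatemanHorn.Theses.UnimodularColumns

open scoped BigOperators Topology Manifold Classical MeasureTheory ProbabilityTheory Matrix InnerProductSpace ComplexConjugate ContinuousMap
open Filter Set Function TopologicalSpace MeasureTheory

attribute [summit_statement] _root_.BatemanHorn

/-- item stmt-Parity-0882 · crux · rank 2 · closed · moot by None · by planner
why it might fail: Likely mis-sited, not false: ψ-expanding the SL₂ fibre counts leaves Σ_{m≍N} μ(m)F(m/N)ρ_h(m)=o(N), h fixed — within DFI1995 Type-I(½)/Type-II(⅓) for root Weyl sums + Harman combinatorics (FM2024 p.15), so not parity-breaking and, lacking a glue to WindowW, not load-bearing; Ω(N) μ–root bias unseen.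
sources: DukeFriedlanderIwaniec1995, Toth2000, FordMaynard2024PrimeSieves = arXiv:2407.14368 p.15 (C-=C+=1 iff theta=0, nu>=1/3 at gamma=1/2; 'limiting version used by DFI'), arXiv:2505.00493 (Grimmelt-Merikoski 2025) Thms 1.4-1.5: uniform Type I (level X^{1/2}) / Type II (N<=X^{1/3}) for roots of al^2+h mod k, Iwaniec2002 Cor 12.2 p.126 = Literature.NumberTheory.Automorphic.sl2BallCount_asymp, BourgainGamburdSarnak2009
[crux] Möbius randomness of a column norm over SL₂(ℤ): ∑_{γ = (a b; c d) ∈ SL₂(ℤ), a²+b²+c²+d² ≤ N}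
μ(a²+c²) = o(N) (#{γ : ‖γ‖² ≤ N} ≍ N; entries range over [−N, N], which the norm condition makes
vacuous). Via LagrangeDictionary this is ∑_{m m' = ν²+1, m + m' ≤ N} μ(m): Möbius against counts of
roots ν of ν² ≡ −1 (mod m) below the height √(m(N−m)), i.e. the parity-window statistic (W) of
QuadraticRoots at the balanced scale D ≍ x with the archimedean weight of the ball; for m > N/2
these are SMALL roots (partial periods), for m ≤ N/2 the rounding errors O(ω(m)) already sum to ≍ N,
so cancellation of μ(m) against root positions is needed throughout. New as stated; open (parity).
Numerically testable. Sources: LiuSarnak2010, BourgainGamburdSarnak2009 (affine sieve on this orbit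
stops at almost-primes), DukeFriedlanderIwaniec1995, Toth2000. -/
@[route_item "route-Parity-UnimodularColumns"]
def UnimodularMobius : Prop :=
  (fun N : ℕ => ∑ a ∈ Finset.Icc (-(N : ℤ)) N, ∑ b ∈ Finset.Icc (-(N : ℤ)) N, ∑ c ∈ Finset.Icc (-(N : ℤ)) N, ∑ d ∈ Finset.Icc (-(N : ℤ)) N, if a * d - b * c = 1 ∧ a ^ 2 + b ^ 2 + c ^ 2 + d ^ 2 ≤ (N : ℤ) then (ArithmeticFunction.moebius (a ^ 2 + c ^ 2).toNat : ℝ) else 0) =o[Filter.atTop] fun N : ℕ => (N : ℝ)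

/-- item stmt-Parity-0883 · crux · rank 3 · closed · moot by None · by planner
why it might fail: |·| inside the γ-sum; a width-1 needle has angular width ≍X^{-1/2} = the GRH/forbidden-region threshold for single sectors (HLR2020 p.3), so all rests on the γ-average; if HLR's a.a.-sector variance method transfers (Λ→μ, sector→ellipse) it is Hecke-side and says nothing on UnimodularMobius; no glue
sources: HuangLiuRudnick2020 = arXiv:1903.04005 p.3 (Ricci |I|>X^{-3/10}; GRH |I|>X^{-1/2+eps}, 'one cannot do better: forbidden regions'), Thm 1 p.3 (a.a. sectors rho<3/5), Thm 4 p.5 (variance), Harman2007 Thm 11.2 p.202 (lower bounds gamma>=X^{-0.381}), p.203 (11.3.2) (Ricci asymptotic gamma>X^{-0.3}), Hecke1920, grounder g9-2 note on stmt-Parity-0883 ('plausibly within HLR variance method'), MarklofWelsh2023 = arXiv:2105.02854 (fine-scale root statistics, unsigned)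
[crux] Unit-width needle family (height Y = √x, here x = N²): ∑_{γ ∈ SL₂(ℤ), ‖γ‖² ≤ N} |∑_{u ∈ ℤ², 0
< |u|² ≤ N} μ(|γu|²)| = o(N²). For each γ the inner sum is Möbius of the norm over the Gaussian
integers v = γu in the ellipse γ(B_√N) of area πN, length ≍ N and width ≍ 1 (e.g. γ = (1 t; 0 1):
∑_{|v| ≤ √N} ∑_{|w − tv| ≲ √N} μ(w² + v²), intervals of length ≍ √w); ≍ N needles, total mass ≍ N².
Threshold member of the family NeedleFamilyFat (θ<1, Hecke territory) — NeedleFamilyHalf (θ=1) —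
UnimodularMobius (θ=2). Open. Sources: Hecke1920 (Gaussian primes in sectors),
DukeFriedlanderIwaniec1995, MarklofWelsh2023. -/
@[route_item "route-Parity-UnimodularColumns"]
def NeedleFamilyHalf : Prop :=
  (fun N : ℕ => ∑ a ∈ Finset.Icc (-(N : ℤ)) N, ∑ b ∈ Finset.Icc (-(N : ℤ)) N, ∑ c ∈ Finset.Icc (-(N : ℤ)) N, ∑ d ∈ Finset.Icc (-(N : ℤ)) N, if a * d - b * c = 1 ∧ a ^ 2 + b ^ 2 + c ^ 2 + d ^ 2 ≤ (N : ℤ) then |∑ u ∈ Finset.Icc (-(N : ℤ)) N, ∑ v ∈ Finset.Icc (-(N : ℤ)) N, if 0 < u ^ 2 + v ^ 2 ∧ u ^ 2 + v ^ 2 ≤ (N : ℤ) then (ArithmeticFunction.moebius ((a * u + b * v) ^ 2 + (c * u + d * v) ^ 2).toNat : ℝ) else 0| else 0) =o[Filter.atTop] fun N : ℕ => (N : ℝ) ^ 2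

/-- item stmt-Parity-0648 · crux · rank 4 · open · by planner
why it might fail: Content: D∈[x(log x)^{-A-2},x^{1+η}] (below, trivial): needs roots-sequence Type-I at level D^{1/2}(log)^{-B} with polylog savings and Type-II down to n≈(log x)^C (beyond DFI1995/GM2025: power windows, X^{o(1)} losses) plus harmonics h≤x^η(log x)^{A+1} for d>x; any may cap the saving. Ω-bias unseen
sources: DukeFriedlanderIwaniec1995, Toth2000, DunnEtAl2019 = arXiv:1908.10143 Thm 7, arXiv:2505.00493 Thms 1.4-1.5 (Type I D<=X^{1/2}, Type II N<=X^{1/3}, bounds up to X^{o(1)}), FordMaynard2024PrimeSieves = arXiv:2407.14368 p.15, Merikoski2022 = arXiv:1908.08816 (largest prime factor of n^2+1: Harman sieve on DFI/Toth Type I/II, lower bounds only)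
(W) for f = X²+1: there is η > 0 such that for every A > 0, all large x and all D with x^{1-η} ≤ D ≤
x^{1+η}: |∑_{D<d≤2D} μ(d) (#{n ≤ x : d ∣ n²+1} - x ω(d)/d)| ≤ x/(log x)^A, ω(d) = polyRootCountMod
(X²+1) d. For d > x this is Möbius against counts of small roots ν ≤ x of ν² ≡ -1 (mod d)
(DFI/Tóth/DKSZ regime). Trivial bound ≍ D·(mean ω) ≫ x. Open; the distinctive spectral crux. -/
@[route_item "route-Parity-UnimodularColumns"]
def WindowW : Prop :=
  ∃ η : ℝ, 0 < η ∧ ∀ A : ℝ, 0 < A → ∃ x₀ : ℝ, ∀ x D : ℝ, x₀ ≤ x → x ^ (1 - η) ≤ D → D ≤ x ^ (1 + η) → abs (∑ d ∈ Finset.Ioc ⌊D⌋₊ ⌊2 * D⌋₊, (ArithmeticFunction.moebius d : ℝ) * (((((Finset.Icc 1 ⌊x⌋₊).filter (fun n : ℕ => d ∣ n ^ 2 + 1)).card : ℕ) : ℝ) - x * (Literature.NumberTheory.Sieve.polyRootCountMod ![(Polynomial.X ^ 2 + 1 : Polynomial ℤ)] d : ℝ) / d)) ≤ x / Real.log x ^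 A

/-- item stmt-Parity-0649 · crux · rank 5 · open · by planner
why it might fail: Already e=1 is Σ_{n≤x}μ(n²+1)≪x/(log x)^{1+δ}: quantitative Chowla for an irreducible quadratic, open even as o(x) (only F_q[u]: SawinShusterman2022 Thm 1.3); |·| over e forbids cancellation across e; cofactor >x^{1+η} is in the FM thin-set blocked half (c=½): no Type-I/II mechanism: parity bet.
sources: SawinShusterman2022 = arXiv:2008.09905 Thm 1.3 and §1.2 p.4 ('the only resolved case is the linear one' over Z), Friedlander2006ProducingPrimes §1 Parity Problem (= book:friedlandernd-analytic-number-theory pp.19-20), FordMaynard2024PrimeSieves §2.4 (thin sets, c=1/2), Literature.Barriers.Parity.FordMaynardLowLevel, Literature.Barriers.Parity.SelbergParityBarrier, stmt-Parity-0650 (pointwise atom, open; Chowla 1965)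
(Q_avg) for f = X²+1: ∃ η, δ > 0: ∑_{e ≤ x^{1-η}} |∑_{n ≤ x, e ∣ n²+1, n²+1 > e·x^{1+η}}
μ((n²+1)/e)| ≪ x/(log x)^{1+δ} (Möbius randomness of the large cofactor along the roots of n²+1 mod
e, on average over e with (log x)^{2+δ} saving over the trivial bound ≍ x log x). Open
(parity-type). -/
@[route_item "route-Parity-UnimodularColumns"]
def CofactorAvg : Prop :=
  ∃ η δ : ℝ, 0 < η ∧ 0 < δ ∧ (fun x : ℝ => ∑ e ∈ Finset.Icc 1 ⌊x ^ (1 - η)⌋₊, |∑ n ∈ (Finset.Icc 1 ⌊x⌋₊).filter (fun n : ℕ => e ∣ n ^ 2 + 1 ∧ (e : ℝ) * x ^ (1 + η) < (n : ℝ) ^ 2 + 1), (ArithmeticFunction.moebius ((n ^ 2 + 1) / e) : ℝ)|) =O[Filter.atTop] fun x : ℝ => x / Real.log x ^ (1 + δ)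

/-- item stmt-Parity-0884 · support · rank 9 · closed · moot by None · by planner
[support] Fat needle family: for every θ ∈ (0,1), ∑_{γ ∈ SL₂(ℤ), ‖γ‖² ≤ N^θ} |∑_{0 < |u|² ≤ N^{2−θ}}
μ(|γu|²)| = o(N²) (needles γ(B_ρ), ρ² = N^{2−θ}, have width ≍ N^{1−θ} → ∞, so each inner sum is
Möbius of the norm over Gaussian integers in a genuinely 2-dimensional region; expected provable
from the prime ideal theorem / Hecke Grössencharakter L-functions for ℚ(i) with error terms uniform
in the eccentricity N^θ, harder as θ → 1). Grounders: record the largest θ covered by the literature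
(Kubilius / Coleman-type sector theorems) as a Literature fact. -/
@[route_item "route-Parity-UnimodularColumns"]
def NeedleFamilyFat : Prop :=
  ∀ θ : ℝ, 0 < θ → θ < 1 → (fun N : ℕ => ∑ a ∈ Finset.Icc (-(N : ℤ)) N, ∑ b ∈ Finset.Icc (-(N : ℤ)) N, ∑ c ∈ Finset.Icc (-(N : ℤ)) N, ∑ d ∈ Finset.Icc (-(N : ℤ)) N, if a * d - b * c = 1 ∧ ((a ^ 2 + b ^ 2 + c ^ 2 + d ^ 2 : ℤ) : ℝ) ≤ (N : ℝ) ^ θ then |∑ u ∈ Finset.Icc (-((N : ℤ)) ^ 2) ((N : ℤ) ^ 2), ∑ v ∈ Finset.Icc (-((N : ℤ)) ^ 2) ((N : ℤ) ^ 2), if 0 < u ^ 2 + v ^ 2 ∧ ((u ^ 2 + v ^ 2 : ℤ) : ℝ) ≤ (N : ℝ) ^ (2 - θ) then (ArithmeticFunction.moebius ((a * u + b * v) ^ 2 + (c * u + d * v) ^ 2).toNat : ℝ) else 0| else 0) =o[Filter.atTop] fun N : ℕ => (N : ℝ) ^ 2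

/-- item stmt-Parity-0885 · support · rank 9 · closed · moot by None · by planner
[support] One fixed needle: for every (a b; c d) ∈ SL₂(ℤ), ∑_{0 < u²+v² ≤ N} μ((au+bv)² + (cu+dv)²)
= o(N). Since u ↦ γu is a bijection of ℤ² this is ∑ μ(N(z)) over Gaussian integers z in the fixed
ellipse γ(B_√N): the prime ideal theorem for ℤ[i] in a fixed smooth region (Landau1903 / Hecke1920).
Provable given PNT-for-ℤ[i]-type Literature facts; the base case θ → 0 of the needle family. -/
@[route_item "route-Parity-UnimodularColumns"]
def NeedleFixed : Prop :=
  ∀ a b c d : ℤ, a * d - b * c = 1 → (fun N : ℕ => ∑ u ∈ Finset.Icc (-(N : ℤ)) N, ∑ v ∈ Finset.Icc (-(N : ℤ)) N, if 0 < u ^ 2 + v ^ 2 ∧ u ^ 2 + v ^ 2 ≤ (N : ℤ) then (ArithmeticFunction.moebius ((a * u + b * v) ^ 2 + (c * u + d * v) ^ 2).toNat : ℝ) else 0) =o[Filter.atTop] fun N : ℕ => (N : ℝ)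

/-- item stmt-Parity-0886 · support · rank 9 · closed · moot by None · by planner
[support] Lagrange dictionary, elementary and provable now: for every N and every F : ℤ → ℤ → ℤ → ℝ,
∑_{γ ∈ SL₂(ℤ), ‖γ‖² ≤ N} F(a²+c², ab+cd, b²+d²) = 4 · ∑_{m, m' ≥ 1, ν ∈ ℤ, m m' = ν²+1, m + m' ≤ N}
F(m, ν, m'). Proof: (a²+c²)(b²+d²) − (ab+cd)² = (ad − bc)² = 1 and ‖γ‖² = m + m' give the map; its
fibres are left SO₂(ℤ)-cosets (order 4: γ' with the same Gram matrix γ'ᵀγ' = γᵀγ differs by γ'γ⁻¹ ∈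
O₂ ∩ SL₂(ℤ)); surjectivity = every positive-definite integral binary form m X² + 2ν XY + m' Y² of
determinant 1 is SL₂(ℤ)-equivalent to X² + Y² (reduction; class number one for discriminant −4).
Index ranges: m, m' ≤ N and |ν| ≤ √(mm') ≤ N are implied by m + m' ≤ N. -/
@[route_item "route-Parity-UnimodularColumns"]
def LagrangeDictionary : Prop :=
  ∀ (N : ℕ) (F : ℤ → ℤ → ℤ → ℝ), (∑ a ∈ Finset.Icc (-(N : ℤ)) N, ∑ b ∈ Finset.Icc (-(N : ℤ)) N, ∑ c ∈ Finset.Icc (-(N : ℤ)) N, ∑ d ∈ Finset.Icc (-(N : ℤ)) N, if a * d - b * c = 1 ∧ a ^ 2 + b ^ 2 + c ^ 2 + d ^ 2 ≤ (N : ℤ) then F (a ^ 2 + c ^ 2) (a * b + c * d) (b ^ 2 + d ^ 2) else 0) = 4 * ∑ m ∈ Finset.Icc (1 : ℤ) N, ∑ ν ∈ Finset.Icc (-(N : ℤ)) N, ∑ m' ∈ Finset.Icc (1 : ℤ) N, if m * m' = ν ^ 2 + 1 ∧ m + m' ≤ (N : ℤ) then F m ν m' else 0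

/-- item stmt-Parity-0647 · assembly · rank 1 · open · by planner
Assembly, first (provable) piece: (W) ∧ (Q_avg) ∧ tendsto_hardyLittlewoodE_partial →
HardyLittlewoodConjE (#{n ≤ x : n²+1 prime} ~ (𝔖/2) x/log x). Bookkeeping: Λ(n²+1) = ∑_{de=n²+1}
μ(d) log e; d < x^{1-η}: Type-I (T1, elementary, r_d = O(ω(d))) with main term H x, H = -∑_d
μ(d)ω(d) log d/d = ∏_p (1-ω(p)/p)(1-1/p)^{-1} = hardyLittlewoodEConst (needs ∑_{d<D} μ(d)ω(d)/d ≪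
(log D)^{-A}, PNT for ℚ(i)); window d ∈ [x^{1-η},x^{1+η}]: (W) with log weights by partial summation
over dyadic D; d > x^{1+η} ⇔ e < x^{1-η}: (Q_avg); then pass from Λ-weights to the count (prime
powers negligible) and use Literature.NumberTheory.Sieve.HardyLittlewoodConjE.isEquivalent. Full
assembly X3 → Parity: same for general f (window [x^{1-η}, x^{g/2+η}]) and k ≥ 2 via tuple weights
(informal), conjoined with GHL. -/
@[route_item "route-Parity-UnimodularColumns"]
def Assembly : Prop :=
  (∃ η : ℝ, 0 < η ∧ ∀ A : ℝ, 0 < A → ∃ x₀ : ℝ, ∀ x D : ℝ, x₀ ≤ x → x ^ (1 - η) ≤ D → D ≤ x ^ (1 + η) → abs (∑ d ∈ Finset.Ioc ⌊D⌋₊ ⌊2 * D⌋₊, (ArithmeticFunction.moebius d : ℝ) * (((((Finset.Icc 1 ⌊x⌋₊).filter (fun n : ℕ => d ∣ n ^ 2 + 1)).card : ℕ) : ℝ) - x * (Literature.NumberTheory.Sieve.polyRootCountMod ![(Polynomial.X ^ 2 + 1 : Polynomial ℤ)] d : ℝ) / d)) ≤ x / Real.log x ^ A) → (∃ η δ : ℝ,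 0 < η ∧ 0 < δ ∧ (fun x : ℝ => ∑ e ∈ Finset.Icc 1 ⌊x ^ (1 - η)⌋₊, |∑ n ∈ (Finset.Icc 1 ⌊x⌋₊).filter (fun n : ℕ => e ∣ n ^ 2 + 1 ∧ (e : ℝ) * x ^ (1 + η) < (n : ℝ) ^ 2 + 1), (ArithmeticFunction.moebius ((n ^ 2 + 1) / e) : ℝ)|) =O[Filter.atTop] fun x : ℝ => x / Real.log x ^ (1 + δ)) → Literature.NumberTheory.Sieve.tendsto_hardyLittlewoodE_partial → Literature.NumberTheory.Sieve.HardyLittlewoodConjE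

end Summit.Parity.BatemanHorn.Theses.UnimodularColumns
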